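import Mathlib
import Literature.NumberTheory.LFunctions.Zhang2022.SkeletonPartOneB
import Literature.NumberTheory.LFunctions.Zhang2022.Section5Lemma54SizeOne
import Literature.NumberTheory.LFunctions.Zhang2022.Section5Lemma54Params
import Literature.NumberTheory.LFunctions.Zhang2022.TypedSection05C
import HarnessLib

/-!
# Zhang (2022), §5, Lemma 5.4 — DISCHARGED: the skeleton node `Skeleton.Lemma54` holds

Topic `Literature/NumberTheory/LFunctions/Zhang2022` (Landau–Siegel audit tree; verdict-neutral).
Y. Zhang, *Discrete mean estimates and the Landau–Siegel zero*, arXiv:2211.02515v1 (2022)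
[Zhang2022LandauSiegel] — **an unrefereed manuscript under adjudication** (D-0069 width campaign;
DAG node `Z22:Lem5.4` + `Z22:Lem5.4.pf`, PDF pp. 28–29, tex L1523–L1559; DISCHARGE.tsv row D07,
cone C15 = leaf `h54` of `Skeleton.theorem1_of_leaves`):

> **Lemma 5.4.** (i). If `1/2 ≤ σ ≤ 2`, then `δ(s) ≪ 𝓛ᶜ|s|⁻²`.
> (ii). If `|s − 1| < 10α`, then `δ(s) = 1 + O(α log 𝓛)`.

(`δ(s) = ∫₀^∞ Δ(x)x^{s−1} dx` (5.14) at the manuscript's parameters `𝓛₂ = 𝓛⁴⁰⁰`, `t₀ = 𝓛⁵¹⁹`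
— the skeleton's `deltaW D`; `𝓛 = log D`, `𝓛₁ = 𝓛⁴⁰⁵`, `α = π/log P = π𝓛⁻⁹`; Lemma 5.4 is
stated BEFORE the blanket assumption (A) of p. 29 and is unconditional.)

This file PROVES the node as typed (`Skeleton.lemma54_holds : Skeleton.Lemma54`, with `k = 5190`
and threshold `log D ≥ 4`), from the free-parameter kernel theorems of the tree: part (i) with its
size `Lemma53.norm_delta514_le_explicit` (`Section5Lemma54SizeOne`, on top of
`Section5Lemma54PartOne`) and part (ii) with its size `Lemma53.norm_delta514_sub_one_le_param`
(`Section5Lemma54Params`, on top of `Section5Lemma54PartTwo`/`SizeTwo` and Lemma 5.3's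
(5.8)/(5.9) files `Section5Lemma53CaseOne/CaseTwo`):

* (private) `alpha_eq` — `α = π𝓛⁻⁹`; `deltaW_eq` — `deltaW D = δ₅₁₄(𝓛⁴⁰⁰, 𝓛⁵¹⁹)` (by `rfl`);
* `Skeleton.norm_deltaW_le` — (i): `‖δ(s)‖ ≤ (2J₂(1) + 4C₂₅)·𝓛⁵¹⁹⁰·‖s‖⁻²` for `𝓛 ≥ 1`;
* `Skeleton.lemma54_holds` — **the node**; and, as one-line corollaries, the typed split nodes
  of `TypedSection05C` (L1-t10): `Typed.Section05C.lemma54i_holds` (`Z22:§5.u030`, part (i)),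
  `lemma54ii_holds` (`Z22:§5.u031`, part (ii)) via `lemma54_iff`, and `ded54_holds`
  (`Z22:Lem5.4.pf`, `Ded54 = Lemma53 → Lemma54`).

What is NOT asserted: anything about Theorems 1–2 of the source or about Landau–Siegel zeros;
`typed ≠ discharged` for every OTHER node; nothing here bears on the cell's verdict on (8.24).
A proof file: no new definitions, no new facts (FACT-LIST untouched).

## References

* Y. Zhang, arXiv:2211.02515v1 (2022), §5 Lemma 5.4, (5.14); §2 (2.1), (2.6), (2.8), (2.15).
  [cite: Zhang2022LandauSiegel, §5 Lemma 5.4]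
-/

noncomputable section

open Complex Real Set MeasureTheory Filter

namespace Literature.NumberTheory.LFunctions.Zhang2022.Skeleton

open Lemma53 SmoothWeight

/-! ## The manuscript's parameters -/

/-- `α = π/𝓛⁹` (`α = π/log P` with `P = e^{𝓛⁹}` (2.6)). [cite: Zhang2022LandauSiegel, §2 (2.6)] -/
private theorem alpha_eq (D : ℕ) : alpha D = π / ell D ^ 9 := by
  unfold alpha bigP; rw [Real.log_exp]

/-- The skeleton's `δ` is the tree's `δ₅₁₄` at `𝓛₂ = 𝓛⁴⁰⁰`, `t₀ = 𝓛⁵¹⁹` ((2.15), (2.8)).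
[cite: Zhang2022LandauSiegel, §5 (5.14)] -/
private theorem deltaW_eq (D : ℕ) (s : ℂ) : deltaW D s = delta514 (ell D ^ 400) (ell D ^ 519) s := rfl

/-! ## Part (i) under the manuscript's parameters -/

/-- **Lemma 5.4 (i) with `c = 5190`**: for `𝓛 ≥ 1` and `1/2 ≤ σ ≤ 2`,
`‖δ(s)‖ ≤ (2J₂(1) + 4C₂₅)·𝓛⁵¹⁹⁰·‖s‖⁻²` (`C₂₅` the absolute constant of
`Lemma53.norm_delta514_le_explicit`; `𝓛₂¹⁰ + t₀¹⁰ = 𝓛⁴⁰⁰⁰ + 𝓛⁵¹⁹⁰ ≤ 2𝓛⁵¹⁹⁰`).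
[cite: Zhang2022LandauSiegel, §5 Lemma 5.4 (i)] -/
theorem norm_deltaW_le {D : ℕ} (hL : 1 ≤ ell D) {s : ℂ} (h1 : 1 / 2 ≤ s.re) (h2 : s.re ≤ 2) :
    ‖deltaW D s‖
      ≤ (2 * Jconst 1 2
          + 4 * ((2 + Real.exp 1) * (4 * π) ^ 2 * Real.exp (((5 : ℕ) : ℝ) ^ 2)
              + (Real.exp 1 * ((2 * 5).factorial : ℝ) + 5 ^ 5) * Jconst 1 2))
        * ell D ^ 5190 * ‖s‖⁻¹ ^ 2 := by
  have hL2 : 1 ≤ ell D ^ 400 := one_le_pow₀ hL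
  have ht : 1 ≤ ell D ^ 519 := one_le_pow₀ hL
  have h := norm_delta514_le_explicit hL2 ht h1 h2
  rw [deltaW_eq]
  refine h.trans ?_
  have hJ0 : 0 ≤ Jconst 1 2 := Jconst_nonneg' 1 2
  have hC0 : 0 ≤ (2 + Real.exp 1) * (4 * π) ^ 2 * Real.exp (((5 : ℕ) : ℝ) ^ 2)
      + (Real.exp 1 * ((2 * 5).factorial : ℝ) + 5 ^ 5) * Jconst 1 2 := by positivity
  have e1 : (ell D ^ 400) ^ (2 * 5) = ell D ^ 4000 := by rw [← pow_mul]
  have e2 : (ell D ^ 519) ^ (2 * 5) = ell D ^ 5190 := by rw [← pow_mul]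
  have hL5190 : 1 ≤ ell D ^ 5190 := one_le_pow₀ hL
  have h4000 : ell D ^ 4000 ≤ ell D ^ 5190 := pow_le_pow_right₀ hL (by norm_num)
  have hnum : 2 * Jconst 1 2
        + 2 * (((2 + Real.exp 1) * (4 * π) ^ 2 * Real.exp (((5 : ℕ) : ℝ) ^ 2)
            + (Real.exp 1 * ((2 * 5).factorial : ℝ) + 5 ^ 5) * Jconst 1 2)
          * ((ell D ^ 400) ^ (2 * 5) + (ell D ^ 519) ^ (2 * 5)))
      ≤ (2 * Jconst 1 2
          + 4 * ((2 + Real.exp 1) * (4 * π) ^ 2 * Real.exp (((5 : ℕ) : ℝ) ^ 2)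
              + (Real.exp 1 * ((2 * 5).factorial : ℝ) + 5 ^ 5) * Jconst 1 2))
        * ell D ^ 5190 := by
    rw [e1, e2]; nlinarith
  rw [div_eq_mul_inv, ← inv_pow]
  exact mul_le_mul_of_nonneg_right hnum (by positivity)

/-! ## The node -/

/-- **Lemma 5.4 of the manuscript HOLDS as typed** (`Skeleton.Lemma54`, with `k = 5190` and an
absolute `C`): for all large `D` (indeed `log D ≥ 4`) and every `s`,
(i) `1/2 ≤ σ ≤ 2 ⇒ ‖δ(s)‖ ≤ C𝓛⁵¹⁹⁰‖s‖⁻²` and (ii) `|s − 1| < 10α ⇒ ‖δ(s) − 1‖ ≤ Cα log 𝓛`.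
Kernel-checked from the tree's Lemma 5.3/5.4 files; unconditional ((A) is not used — Lemma 5.4
precedes the blanket assumption of p. 29). DISCHARGES leaf `h54` of `theorem1_of_leaves`.
[cite: Zhang2022LandauSiegel, §5 Lemma 5.4] -/
theorem lemma54_holds : Lemma54 := by
  set Ci : ℝ := 2 * Jconst 1 2
      + 4 * ((2 + Real.exp 1) * (4 * π) ^ 2 * Real.exp (((5 : ℕ) : ℝ) ^ 2)
          + (Real.exp 1 * ((2 * 5).factorial : ℝ) + 5 ^ 5) * Jconst 1 2) with hCi
  set Cii : ℝ := (20800 + (12 * (Nat.factorial 41 : ℝ) + 1344 + (5 + 18 * (Nat.factorial 10 : ℝ)))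
      + 17592 + 1) with hCii
  refine ⟨5190, max Ci Cii, ⌈Real.exp 4⌉₊, fun D _ χ hD _ _ s => ?_⟩
  have hD4 : Real.exp 4 ≤ D := le_trans (Nat.le_ceil _) (by exact_mod_cast hD)
  have hD0 : (0 : ℝ) < D := lt_of_lt_of_le (Real.exp_pos 4) hD4
  have hL4 : 4 ≤ ell D := by
    unfold ell; rwa [Real.le_log_iff_exp_le hD0]
  have hL1 : 1 ≤ ell D := by linarith
  refine ⟨fun h1 h2 => ?_, fun hs => ?_⟩
  · refine (norm_deltaW_le hL1 h1 h2).trans ?_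
    have h0 : 0 ≤ ell D ^ 5190 * ‖s‖⁻¹ ^ 2 := by positivity
    calc Ci * ell D ^ 5190 * ‖s‖⁻¹ ^ 2 = Ci * (ell D ^ 5190 * ‖s‖⁻¹ ^ 2) := by ring
      _ ≤ max Ci Cii * (ell D ^ 5190 * ‖s‖⁻¹ ^ 2) :=
          mul_le_mul_of_nonneg_right (le_max_left _ _) h0
      _ = max Ci Cii * ell D ^ 5190 * ‖s‖⁻¹ ^ 2 := by ring
  · rw [alpha_eq] at hs ⊢
    rw [deltaW_eq]
    refine (norm_delta514_sub_one_le_param hL4 hs).trans ?_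
    have hlog : 0 ≤ Real.log (ell D) := Real.log_nonneg hL1
    have h0 : 0 ≤ π / ell D ^ 9 * Real.log (ell D) := by positivity
    calc Cii * (π / ell D ^ 9) * Real.log (ell D) = Cii * (π / ell D ^ 9 * Real.log (ell D)) := by ring
      _ ≤ max Ci Cii * (π / ell D ^ 9 * Real.log (ell D)) :=
          mul_le_mul_of_nonneg_right (le_max_right _ _) h0
      _ = max Ci Cii * (π / ell D ^ 9) * Real.log (ell D) := by ring

end Literature.NumberTheory.LFunctions.Zhang2022.Skeleton

/-! ## The typed split nodes of `TypedSection05C` (parts (i), (ii) and the proof node) -/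

namespace Literature.NumberTheory.LFunctions.Zhang2022.Typed.Section05C

/-- **`Z22:§5.u030` — Lemma 5.4 (i) as typed in `TypedSection05C` (`Lemma54i`) HOLDS**, from the
node via the typer's split `lemma54_iff`. [cite: Zhang2022LandauSiegel, §5 Lemma 5.4 (i)] -/
theorem lemma54i_holds : Lemma54i := (lemma54_iff.mp Skeleton.lemma54_holds).1

/-- **`Z22:§5.u031` — Lemma 5.4 (ii) as typed in `TypedSection05C` (`Lemma54ii`) HOLDS**, from the
node via `lemma54_iff`. [cite: Zhang2022LandauSiegel, §5 Lemma 5.4 (ii)] -/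
theorem lemma54ii_holds : Lemma54ii := (lemma54_iff.mp Skeleton.lemma54_holds).2

/-- **`Z22:Lem5.4.pf` — the proof node `Ded54 : Lemma53 → Lemma54` HOLDS** (its conclusion is now a
theorem; the manuscript's route through Lemma 5.3 is the one kernel-checked in the tree's
`Section5Lemma54PartOne/PartTwo`, which this discharge uses). [cite: Zhang2022LandauSiegel, §5 Lemma 5.4 (proof)] -/
theorem ded54_holds : Ded54 := fun _ => Skeleton.lemma54_holds

end Literature.NumberTheory.LFunctions.Zhang2022.Typed.Section05C
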